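import Summits.PneNP.GCT.Max.SF6PermanentSide
import HarnessLib
import HarnessLib.Audit

/-!
# `GCT/Max`: the padded-`per_m` side for every `m` — no-syzygy upper bounds for the Koszul–Young ranks of `X₀₀^{n-m}·per_m`

Cell `pub-gct-max` (HOME `run/shared/lean/pub/pub-gct-max/`), track F, banked input P4 (director-valiant g7 ROW-SUPPLY W1, LEAD
gen 31 desk): the ALL-`m` generalisation of the located negative N-F-1 / C-F-3′ (module `KYCannotSeparatePaddedPerThreeFromFive`,
`m = 3`, `n ≥ 5`). THIS MODULE = the permanent-side layer for general `m`, written and kernel-checked by theory-2 (gen 25): the three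
bounds of `Max/SF6PermanentSide` (`m = 3`, theory-2 / lit-2) with `3` replaced by `m`, by the same devices — lit-2's
`kyRank_le_shiftedPartialsRank_mul_choose` (+ `succ`), the tree's `shiftedPartialsRank_paddedPerPoly_le_sum_mul` /
`shiftedPartialsRank_zero_blockPer_le` (any `m ≤ n`), and the refined Leibniz bound `SF6Leibniz.shiftedPartialsRank_zero_X_pow_mul_le_filter`
(which gives the HIGH-order form without transpose duality or Hilbert-function symmetry). Mathematics: memo `CF3-THEOREM.md` §1 (v1.1
`9ea98dd57dfc3673`, referee-read PASS 2026-08-23; NOT IN PRINT). Everything PROVED; no conjecture of the cell is used or asserted.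
HONEST FRAMING: certified rank UPPER bounds for ONE family of equations (plain Koszul–Young flattenings `Λ^p ⊗ S^k`) on padded
permanents — ingredients of a LOCATED NEGATIVE, not a statement about other Young flattenings, border apolarity or multiplicity
obstructions; occurrence obstructions are ruled out in print (BIP'16) — multiplicity obstructions are the open door; nothing here is a
claim on VP vs VNP or P vs NP.

**Contents** (`Q = X₀₀^{n-m}·per_m ∈ S^n(ℂ^{n²})`, `m ≤ n`, all `p, k`; `S(m,k) = Σ_{j ≤ k} C(m,j)²` written out as a `Finset.range` sum —
it is `KYAllM.chooseSqSum m k` of `Max/KYAllMArithmetic`):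
* `KYPaddedPerSide.shiftedPartialsRank_paddedPerPoly_le_filter` — `h_Q(k) ≤ Σ_{j ≤ k, k-j ≤ n-m} C(m,j)²`, and the reindexing
  `KYPaddedPerSide.sum_filter_choose_sq_le` (`j ↦ m - j`): `… ≤ S(m, n-k)`;
* `KYPaddedPerSide.kyRank_paddedPerPoly_le_low` — `rank KY_{p,k}(Q) ≤ min (S(m,k)·C(n²,p)) (S(m,k+1)·C(n²,p+1))`;
* `KYPaddedPerSide.kyRank_paddedPerPoly_le_high` — `rank KY_{p,k}(Q) ≤ min (S(m,n-k)·C(n²,p)) (S(m,n-(k+1))·C(n²,p+1))`;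
* `KYPaddedPerSide.kyRank_paddedPerPoly_eq_zero` — `rank KY_{p,k}(Q) = 0` for `k ≥ n`;
packaged as `PaddedPerKYUpperBounds` with `paddedPerKYUpperBounds_holds` (at `m = 3`: `PaddedPerThreeKYUpperBounds`).
Consumer: `Max/KYCannotSeparatePaddedPerAllM` (the node `KYCannotSeparatePaddedPerAllM`: N-F-1 for every `m`, every `n ≥ 2m+2`).
-/

noncomputable section

namespace Summit.PneNP.GCT

namespace KYPaddedPerSide

open MvPolynomial Finset Literature.Computability.AlgebraicComplexity Literature.Barriers.ValiantsHypothesis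

/-! ## The refined Leibniz bound for the padded `m × m` permanent and its reindexing -/

/-- `h_{X₀₀^{n-m}·per_m}(k) ≤ Σ_{j ≤ k, k - j ≤ n - m} C(m,j)²` (refined Leibniz + `h_{per_m-block}(j) ≤ C(m,j)²`). [folklore] -/
theorem shiftedPartialsRank_paddedPerPoly_le_filter (m n : ℕ) [NeZero n] (hmn : m ≤ n) (k : ℕ) :
    shiftedPartialsRank ℂ k 0 (paddedPerPoly ℂ m n) ≤
      ∑ j ∈ (range (k + 1)).filter (fun j => k ≤ (n - m) + j), (m.choose j) ^ 2 := by
  classical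
  rw [paddedPerPoly]
  refine (SF6Leibniz.shiftedPartialsRank_zero_X_pow_mul_le_filter _ _ _ k).trans ?_
  exact Finset.sum_le_sum fun j _ => shiftedPartialsRank_zero_blockPer_le hmn j

/-- Reindexing `j ↦ m - j`: `Σ_{j ≤ k, k - j ≤ a} C(m,j)² ≤ Σ_{i ≤ a + m - k} C(m,i)²` (terms with `j > m` vanish). [folklore] -/
theorem sum_filter_choose_sq_le (m k a : ℕ) :
    ∑ j ∈ (range (k + 1)).filter (fun j => k ≤ a + j), (m.choose j) ^ 2 ≤
      ∑ i ∈ range (a + m - k + 1), (m.choose i) ^ 2 := by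
  classical
  set S := (range (k + 1)).filter (fun j => k ≤ a + j) with hS
  have h1 : ∑ j ∈ S, (m.choose j) ^ 2 = ∑ j ∈ S.filter (fun j => j ≤ m), (m.choose j) ^ 2 := by
    refine (Finset.sum_filter_of_ne (s := S) (p := fun j => j ≤ m) (fun j _ hne => ?_)).symm
    by_contra hj
    exact hne (by rw [Nat.choose_eq_zero_of_lt (by omega)]; simp)
  have h2 : ∑ j ∈ S.filter (fun j => j ≤ m), (m.choose j) ^ 2 =
      ∑ j ∈ S.filter (fun j => j ≤ m), (m.choose (m - j)) ^ 2 := by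
    refine Finset.sum_congr rfl fun j hj => ?_
    rw [Finset.mem_filter] at hj
    rw [Nat.choose_symm hj.2]
  have h3 : ∑ j ∈ S.filter (fun j => j ≤ m), (m.choose (m - j)) ^ 2 =
      ∑ i ∈ (S.filter (fun j => j ≤ m)).image (fun j => m - j), (m.choose i) ^ 2 := by
    rw [Finset.sum_image]
    intro x hx y hy hxy
    rw [Finset.coe_filter, Set.mem_setOf_eq] at hx hy
    simp only at hxy
    omega
  have h4 : (S.filter (fun j => j ≤ m)).image (fun j => m - j) ⊆ range (a + m - k + 1) := by
    intro i hi
    rw [Finset.mem_image] at hi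
    obtain ⟨j, hj, rfl⟩ := hi
    rw [Finset.mem_filter, hS, Finset.mem_filter, Finset.mem_range] at hj
    rw [Finset.mem_range]
    omega
  rw [h1, h2, h3]
  exact Finset.sum_le_sum_of_subset h4

/-- Hence the HIGH-order partials bound `h_{X₀₀^{n-m}·per_m}(k) ≤ S(m, n-k)` (`m ≤ n`). [folklore] -/
theorem shiftedPartialsRank_paddedPerPoly_le_high (m n : ℕ) [NeZero n] (hmn : m ≤ n) (k : ℕ) :
    shiftedPartialsRank ℂ k 0 (paddedPerPoly ℂ m n) ≤ ∑ i ∈ range (n - k + 1), (m.choose i) ^ 2 := by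
  have h := (shiftedPartialsRank_paddedPerPoly_le_filter m n hmn k).trans (sum_filter_choose_sq_le m k (n - m))
  rwa [show n - m + m - k = n - k by omega] at h

/-- The LOW-order partials bound `h_{X₀₀^{n-m}·per_m}(k) ≤ S(m,k)` (the tree's `shiftedPartialsRank_paddedPerPoly_le_sum_mul` at
shift `τ = 0`). [folklore] -/
theorem shiftedPartialsRank_paddedPerPoly_le_low (m n : ℕ) [NeZero n] (hmn : m ≤ n) (k : ℕ) :
    shiftedPartialsRank ℂ k 0 (paddedPerPoly ℂ m n) ≤ ∑ i ∈ range (k + 1), (m.choose i) ^ 2 := by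
  have h := shiftedPartialsRank_paddedPerPoly_le_sum_mul (K := ℂ) (m := m) (n := n) hmn k 0
  simpa using h

/-! ## The Koszul–Young rank bounds -/

/-- Orders `k ≥ n` of the degree-`n` form `X₀₀^{n-m}·per_m` have `KY_{p,k} = 0`. [folklore] -/
theorem kyRank_paddedPerPoly_eq_zero (m n : ℕ) [NeZero n] (p k : ℕ) (hmn : m ≤ n) (hk : n ≤ k) :
    kyRank ℂ p k (paddedPerPoly ℂ m n) = 0 := by
  rw [kyRank_def]
  exact SF6PerSide.kyRankFin_eq_zero_of_isHomogeneous p k _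
    ((paddedPerPoly_isHomogeneous (k := ℂ) hmn).rename_isHomogeneous) hk

/-- **Low-order no-syzygy bound** (`m ≤ n`): `rank KY_{p,k}(X₀₀^{n-m}·per_m) ≤ min (S(m,k)·C(n²,p)) (S(m,k+1)·C(n²,p+1))`. [folklore] -/
theorem kyRank_paddedPerPoly_le_low (m n : ℕ) [NeZero n] (p k : ℕ) (hmn : m ≤ n) :
    kyRank ℂ p k (paddedPerPoly ℂ m n) ≤
      min ((∑ i ∈ range (k + 1), (m.choose i) ^ 2) * (n * n).choose p)
        ((∑ i ∈ range (k + 1 + 1), (m.choose i) ^ 2) * (n * n).choose (p + 1)) := by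
  refine le_min ?_ ?_
  · refine (kyRank_le_shiftedPartialsRank_mul_choose p k _).trans ?_
    rw [Fintype.card_prod, Fintype.card_fin]
    exact Nat.mul_le_mul_right _ (shiftedPartialsRank_paddedPerPoly_le_low m n hmn k)
  · refine (kyRank_le_shiftedPartialsRank_succ_mul_choose p k _).trans ?_
    rw [Fintype.card_prod, Fintype.card_fin]
    exact Nat.mul_le_mul_right _ (shiftedPartialsRank_paddedPerPoly_le_low m n hmn (k + 1))

/-- **High-order no-syzygy bound** (`m ≤ n`): `rank KY_{p,k}(X₀₀^{n-m}·per_m) ≤ min (S(m,n-k)·C(n²,p)) (S(m,n-(k+1))·C(n²,p+1))` —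
from the refined Leibniz bound and the reindexing `j ↦ m - j`; no transpose duality needed. [folklore] -/
theorem kyRank_paddedPerPoly_le_high (m n : ℕ) [NeZero n] (p k : ℕ) (hmn : m ≤ n) :
    kyRank ℂ p k (paddedPerPoly ℂ m n) ≤
      min ((∑ i ∈ range (n - k + 1), (m.choose i) ^ 2) * (n * n).choose p)
        ((∑ i ∈ range (n - (k + 1) + 1), (m.choose i) ^ 2) * (n * n).choose (p + 1)) := by
  refine le_min ?_ ?_
  · refine (kyRank_le_shiftedPartialsRank_mul_choose p k _).trans ?_
    rw [Fintype.card_prod, Fintype.card_fin]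
    exact Nat.mul_le_mul_right _ (shiftedPartialsRank_paddedPerPoly_le_high m n hmn k)
  · refine (kyRank_le_shiftedPartialsRank_succ_mul_choose p k _).trans ?_
    rw [Fintype.card_prod, Fintype.card_fin]
    exact Nat.mul_le_mul_right _ (shiftedPartialsRank_paddedPerPoly_le_high m n hmn (k + 1))

end KYPaddedPerSide

/-! ## The packaged statement of this module (PROVED) -/

open Finset Literature.Computability.AlgebraicComplexity Literature.Barriers.ValiantsHypothesis in
/-- **Permanent-side upper bounds for the padded `m × m` permanent, every `m`** (`m ≤ n`, all `p, k`; `S(m,k) = Σ_{i ≤ k} C(m,i)²`):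
the low-order bound `rank KY_{p,k}(X₀₀^{n-m}·per_m) ≤ min (S(m,k)·C(n²,p)) (S(m,k+1)·C(n²,p+1))`, the high-order bound
`≤ min (S(m,n-k)·C(n²,p)) (S(m,n-k-1)·C(n²,p+1))`, and vanishing for `k ≥ n`. Statements of the cell (CF3-THEOREM §1 for general `m`;
at `m = 3` = `PaddedPerThreeKYUpperBounds`), PROVED below; not published theorems. [folklore] -/
def PaddedPerKYUpperBounds : Prop :=
  ∀ (m n : ℕ) [NeZero n] (p k : ℕ), m ≤ n →
    kyRank ℂ p k (paddedPerPoly ℂ m n) ≤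
      min ((∑ i ∈ range (k + 1), (m.choose i) ^ 2) * (n * n).choose p)
        ((∑ i ∈ range (k + 1 + 1), (m.choose i) ^ 2) * (n * n).choose (p + 1)) ∧
    kyRank ℂ p k (paddedPerPoly ℂ m n) ≤
      min ((∑ i ∈ range (n - k + 1), (m.choose i) ^ 2) * (n * n).choose p)
        ((∑ i ∈ range (n - (k + 1) + 1), (m.choose i) ^ 2) * (n * n).choose (p + 1)) ∧
    (n ≤ k → kyRank ℂ p k (paddedPerPoly ℂ m n) = 0)

/-- `PaddedPerKYUpperBounds` holds. [folklore] -/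
theorem paddedPerKYUpperBounds_holds : PaddedPerKYUpperBounds :=
  fun m n _ p k hmn => ⟨KYPaddedPerSide.kyRank_paddedPerPoly_le_low m n p k hmn,
    KYPaddedPerSide.kyRank_paddedPerPoly_le_high m n p k hmn,
    fun hk => KYPaddedPerSide.kyRank_paddedPerPoly_eq_zero m n p k hmn hk⟩

end Summit.PneNP.GCT
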